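import Summits.Parity.GeneralizedHardyLittlewood.Theorems.ChenParityOracleBLAPHostParityFromBrickTypeISWTools
import HarnessLib

/-!
# Route `ChenParityOracleBLAP` — crux S1 = `HostParityFromBrick` (stmt-Parity-20045): hypothesis (A₂) for the Liouville function

Support file for the prime half `K1 → K2 → HP1` of S1 (the unconditional Type-I input): BFI's
Siegel–Walfisz hypothesis (A₂) (`Literature.NumberTheory.Sieve.BFI.SiegelWalfiszHyp`) for
`β = λ` at every scale `N ≥ 4` with `B = 2` (`siegelWalfiszHyp_liouville`), from the absolute bound
`abs_disc_liouville_le`: small moduli `k ≤ (log 2N)^{2A+2}` by the Siegel–Walfisz theorem for `λ`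
(`SiegelWalfiszMoebius.liouville_progression` with `SiegelWalfiszMoebius_holds`, both PROVED in the
tree) after the Möbius reduction of `(n, d) = 1` (file `…TypeISWTools`); large moduli by
`BFI.abs_disc_le_large` and `φ(k) ≥ k^{1/2}/C`; conversion to the relative form by
`BFI.relative_of_absolute`.

References: E. Bombieri, J. B. Friedlander, H. Iwaniec, Acta Math. 156 (1986), §1 (A₂)
[BombieriFriedlanderIwaniecActa1986]; H. L. Montgomery, R. C. Vaughan, *Multiplicative Number
Theory I* (2007), §11.3 [MontgomeryVaughan2007].
-/

namespace Summit.Parity.GeneralizedHardyLittlewood.Theorems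

open Finset Real
open scoped ArithmeticFunction.sigma
open ArithmeticFunction (liouville)
open Literature.NumberTheory.Sieve Literature.NumberTheory.Sieve.BFI

/-! ### The absolute (A₂)-bound for `λ` -/

set_option maxHeartbeats 400000 in
/-- **The absolute Siegel–Walfisz discrepancy bound for `λ`.**  For every `A > 0` there is
`T ≥ 0` such that for all `N ≥ 4`, `d, k ≥ 1` and `l` coprime to `k`:
`|∑_{n ∼ N, n ≡ l (k), (n,d)=1} λ(n) − φ(k)⁻¹ ∑_{n ∼ N, (n,dk)=1} λ(n)| ≤ T τ(d)² N/(log 2N)^{A+1/2}`.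
Small `k ≤ (log 2N)^{2A+2}`: Möbius over `e ∣ d` and Siegel–Walfisz for `λ`
(`SiegelWalfiszMoebius.liouville_progression`) at scales `N/e`, `2N/e` for `e ≤ √N`, trivially for
`e > √N`; large `k`: `BFI.abs_disc_le_large` and `φ(k) ≥ k^{1/2}/C` (divisor bound). -/
theorem abs_disc_liouville_le (A : ℝ) (hA : 0 < A) :
    ∃ T : ℝ, 0 ≤ T ∧ ∀ N : ℝ, 4 ≤ N → ∀ d k : ℕ, 1 ≤ d → 1 ≤ k → ∀ l : ℤ, IsCoprime (k : ℤ) l →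
      |(∑ n ∈ (dyadic N).filter (fun n : ℕ => (n : ZMod k) = (l : ZMod k) ∧ n.Coprime d),
          (liouville n : ℝ)) -
        (∑ n ∈ (dyadic N).filter (fun n : ℕ => n.Coprime (d * k)), (liouville n : ℝ)) /
          (Nat.totient k : ℝ)| ≤
        T * (σ 0 d : ℝ) ^ 2 * N / Real.log (2 * N) ^ (A + 1 / 2) := by
  classical
  -- constants
  obtain ⟨C₁, hC₁⟩ := Literature.NumberTheory.LFunctions.SiegelWalfiszMoebius_holds.liouville_progression
    (A := 2 * A + 3) (by positivity) (A + 1)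
  set C := max C₁ 0 with hCdef
  have hC0 : 0 ≤ C := le_max_right _ _
  obtain ⟨Ch, hCh1, hCh⟩ := exists_sigma_zero_le_mul_rpow (ε := (1 / 2 : ℝ)) (by norm_num)
  set cA : ℝ := (2 * (A + 1 / 2)) ^ (A + 1 / 2) * 2 with hcA
  have hcA0 : 0 ≤ cA := by positivity
  set N₀ : ℝ := Real.exp (2 ^ (4 * A + 5)) with hN₀
  set L₀ : ℝ := Real.log (2 * N₀) + 1 with hL₀
  have hL₀1 : 1 ≤ L₀ := by
    have : 0 ≤ Real.log (2 * N₀) := Real.log_nonneg (by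
      have : 1 ≤ N₀ := by rw [hN₀]; exact Real.one_le_exp (by positivity)
      linarith)
    linarith
  set T : ℝ := (2 + cA + 3 * Ch) + 6 * (C * 4 ^ (A + 1) + cA) + 5 * L₀ ^ (A + 1 / 2) with hTdef
  have hT0 : 0 ≤ T := by positivity
  refine ⟨T, hT0, ?_⟩
  intro N hN d k hd hk l hl
  haveI : NeZero k := ⟨by omega⟩
  have hN0 : 0 ≤ N := by linarith
  have hN2 : (2 : ℝ) ≤ N := by linarith
  set L := Real.log (2 * N) with hLdef
  have hL2 : 2 ≤ L := by
    rw [hLdef]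
    have : Real.exp 2 ≤ 2 * N := by
      have h1 := Real.exp_one_lt_d9
      have h0 := Real.exp_pos (1 : ℝ)
      have h2 : Real.exp 2 = Real.exp 1 * Real.exp 1 := by rw [← Real.exp_add]; norm_num
      rw [h2]; nlinarith
    calc (2 : ℝ) = Real.log (Real.exp 2) := (Real.log_exp 2).symm
      _ ≤ Real.log (2 * N) := Real.log_le_log (Real.exp_pos 2) this
  have hL1 : 1 ≤ L := by linarith
  have hL0 : 0 < L := by linarith
  have hLpow : ∀ c : ℝ, 0 < L ^ c := fun c => Real.rpow_pos_of_pos hL0 c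
  have hσ1 : (1 : ℝ) ≤ (σ 0 d : ℝ) := by
    have h : 0 < σ 0 d := by
      rw [ArithmeticFunction.sigma_zero_apply]
      exact Finset.card_pos.mpr ⟨1, Nat.one_mem_divisors.mpr (by omega)⟩
    exact_mod_cast h
  have hσd : (1 : ℝ) ≤ (σ 0 d : ℝ) ^ 2 := by
    rw [sq]; exact one_le_mul_of_one_le_of_one_le hσ1 hσ1
  -- `L^{A+1/2} ≤ cA N` and `√N L^{A+1/2} ≤ cA N`
  have hlsq : L ^ (A + 1 / 2) ≤ (2 * (A + 1 / 2)) ^ (A + 1 / 2) * Real.sqrt (2 * N) :=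
    log_rpow_le_sqrt (by linarith) (by linarith)
  have hsqrt2N : Real.sqrt (2 * N) ≤ 2 * Real.sqrt N := by
    rw [Real.sqrt_mul (by norm_num)]
    have : Real.sqrt 2 ≤ 2 := by
      rw [show (2 : ℝ) = Real.sqrt 4 by rw [show (4:ℝ) = 2^2 by norm_num, Real.sqrt_sq (by norm_num)]]
      exact Real.sqrt_le_sqrt (by norm_num)
    exact mul_le_mul_of_nonneg_right this (Real.sqrt_nonneg _)
  have hsqrtN : Real.sqrt N ≤ N := by
    rw [Real.sqrt_le_left (by linarith)]; nlinarith
  have hLcA : L ^ (A + 1 / 2) ≤ cA * N := by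
    calc L ^ (A + 1 / 2) ≤ (2 * (A + 1 / 2)) ^ (A + 1 / 2) * (2 * Real.sqrt N) :=
          hlsq.trans (mul_le_mul_of_nonneg_left hsqrt2N (by positivity))
      _ = cA * Real.sqrt N := by rw [hcA]; ring
      _ ≤ cA * N := mul_le_mul_of_nonneg_left hsqrtN hcA0
  have hsqL : Real.sqrt N * L ^ (A + 1 / 2) ≤ cA * N := by
    calc Real.sqrt N * L ^ (A + 1 / 2)
        ≤ Real.sqrt N * ((2 * (A + 1 / 2)) ^ (A + 1 / 2) * (2 * Real.sqrt N)) :=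
          mul_le_mul_of_nonneg_left (hlsq.trans (mul_le_mul_of_nonneg_left hsqrt2N (by positivity)))
            (Real.sqrt_nonneg _)
      _ = cA * (Real.sqrt N * Real.sqrt N) := by rw [hcA]; ring
      _ = cA * N := by rw [Real.mul_self_sqrt hN0]
  -- the target is monotone in the numerator constant
  have hgoal : ∀ X S F : ℝ, X ≤ S * F * N / L ^ (A + 1 / 2) → 0 ≤ S → S ≤ T → 1 ≤ F →
      F ≤ (σ 0 d : ℝ) ^ 2 → X ≤ T * (σ 0 d : ℝ) ^ 2 * N / Real.log (2 * N) ^ (A + 1 / 2) := by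
    intro X S F hX hS hST hF1 hF
    refine hX.trans ?_
    rw [← hLdef, div_le_div_iff_of_pos_right (hLpow _)]
    have hF0 : 0 ≤ F := by linarith
    gcongr
  have hT1 : 2 + cA + 3 * Ch ≤ T := by
    rw [hTdef]
    have : 0 ≤ 6 * (C * 4 ^ (A + 1) + cA) := by positivity
    have : 0 ≤ 5 * L₀ ^ (A + 1 / 2) := by positivity
    linarith
  have hT2 : 6 * (C * 4 ^ (A + 1) + cA) ≤ T := by
    rw [hTdef]
    have : 0 ≤ 5 * L₀ ^ (A + 1 / 2) := by positivity
    linarith [hcA0, hCh1]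
  have hT3 : 5 * L₀ ^ (A + 1 / 2) ≤ T := by
    rw [hTdef]
    have : 0 ≤ 6 * (C * 4 ^ (A + 1) + cA) := by positivity
    linarith [hcA0, hCh1]
  have hlu : IsUnit ((l : ZMod k)) := (ZMod.coe_int_isUnit_iff_isCoprime l k).mpr hl
  by_cases hkL : L ^ (2 * A + 2) < (k : ℝ)
  · -- large modulus
    have hlarge := abs_disc_le_large (β := fun n => (liouville n : ℝ)) hN0 zero_le_one
      (fun n _ => Literature.NumberTheory.LFunctions.LiouvilleSum.abs_liouville_le_one n) hk hlu d
    rw [mul_one] at hlarge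
    refine hgoal _ (2 + cA + 3 * Ch) 1 (hlarge.trans ?_) (by positivity) hT1 le_rfl hσd
    have hk0 : (0 : ℝ) < k := by exact_mod_cast hk
    have hφ : (0 : ℝ) < Nat.totient k := by exact_mod_cast Nat.totient_pos.mpr hk
    -- `k ≤ φ(k) τ(k) ≤ φ(k) Ch k^{1/2}`
    have hkφ : (k : ℝ) ≤ (Nat.totient k : ℝ) * (Ch * (k : ℝ) ^ (1 / 2 : ℝ)) := by
      have h1 : k ≤ Nat.totient k * σ 0 k := by
        rw [ArithmeticFunction.sigma_zero_apply]
        calc k = ∑ e ∈ k.divisors, Nat.totient e := (Nat.sum_totient k).symm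
          _ ≤ ∑ _e ∈ k.divisors, Nat.totient k := Finset.sum_le_sum fun e he =>
              Nat.le_of_dvd (Nat.totient_pos.mpr hk)
                (Nat.totient_dvd_of_dvd (Nat.dvd_of_mem_divisors he))
          _ = Nat.totient k * #k.divisors := by rw [Finset.sum_const, smul_eq_mul, mul_comm]
      have h2 : (k : ℝ) ≤ (Nat.totient k : ℝ) * (σ 0 k : ℝ) := by exact_mod_cast h1
      exact h2.trans (mul_le_mul_of_nonneg_left (hCh k) hφ.le)
    -- `k^{1/2} ≥ L^{A+1}`
    have hksqrt : L ^ (A + 1) ≤ (k : ℝ) ^ (1 / 2 : ℝ) := by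
      have : (L ^ (2 * A + 2)) ^ (1 / 2 : ℝ) ≤ (k : ℝ) ^ (1 / 2 : ℝ) :=
        Real.rpow_le_rpow (by positivity) hkL.le (by norm_num)
      rwa [← Real.rpow_mul hL0.le, show (2 * A + 2) * (1 / 2 : ℝ) = A + 1 by ring] at this
    have hφlow : L ^ (A + 1) ≤ Ch * (Nat.totient k : ℝ) := by
      -- from `k ≤ φ · Ch · k^{1/2}` and `k = k^{1/2} k^{1/2}`
      have hk12 : (k : ℝ) = (k : ℝ) ^ (1 / 2 : ℝ) * (k : ℝ) ^ (1 / 2 : ℝ) := by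
        rw [← Real.rpow_add hk0]; norm_num
      have hk12pos : 0 < (k : ℝ) ^ (1 / 2 : ℝ) := Real.rpow_pos_of_pos hk0 _
      have : (k : ℝ) ^ (1 / 2 : ℝ) ≤ (Nat.totient k : ℝ) * Ch := by
        have h := hkφ
        rw [hk12] at h
        have h' : (k : ℝ) ^ (1 / 2 : ℝ) * (k : ℝ) ^ (1 / 2 : ℝ) ≤
            ((Nat.totient k : ℝ) * Ch) * (k : ℝ) ^ (1 / 2 : ℝ) := by linarith [h]
        exact le_of_mul_le_mul_right h' hk12pos
      linarith [hksqrt]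
    have hA1 : L ^ (A + 1 / 2) ≤ L ^ (A + 1) :=
      Real.rpow_le_rpow_of_exponent_le hL1 (by linarith)
    have hA2 : L ^ (A + 1 / 2) ≤ L ^ (2 * A + 2) :=
      Real.rpow_le_rpow_of_exponent_le hL1 (by linarith)
    rw [le_div_iff₀ (hLpow _)]
    -- `(2N/k + 1 + (2N+1)/φ) L^{A+1/2} ≤ 2N + cA N + 3 Ch N`
    have e1 : 2 * N / k * L ^ (A + 1 / 2) ≤ 2 * N := by
      rw [div_mul_eq_mul_div, div_le_iff₀ hk0]
      exact mul_le_mul_of_nonneg_left (hA2.trans hkL.le) (by linarith)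
    have e2 : 1 * L ^ (A + 1 / 2) ≤ cA * N := by rw [one_mul]; exact hLcA
    have e3 : (2 * N + 1) / (Nat.totient k : ℝ) * L ^ (A + 1 / 2) ≤ 3 * Ch * N := by
      rw [div_mul_eq_mul_div, div_le_iff₀ hφ]
      calc (2 * N + 1) * L ^ (A + 1 / 2) ≤ (3 * N) * L ^ (A + 1) :=
            mul_le_mul (by linarith) hA1 (hLpow _).le (by linarith)
        _ ≤ (3 * N) * (Ch * (Nat.totient k : ℝ)) := mul_le_mul_of_nonneg_left hφlow (by linarith)
        _ = 3 * Ch * N * (Nat.totient k : ℝ) := by ring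
    calc (2 * N / k + 1 + (2 * N + 1) / (Nat.totient k : ℝ)) * L ^ (A + 1 / 2)
        = 2 * N / k * L ^ (A + 1 / 2) + 1 * L ^ (A + 1 / 2) +
          (2 * N + 1) / (Nat.totient k : ℝ) * L ^ (A + 1 / 2) := by ring
      _ ≤ 2 * N + cA * N + 3 * Ch * N := add_le_add (add_le_add e1 e2) e3
      _ = (2 + cA + 3 * Ch) * 1 * N := by ring
  · push Not at hkL
    by_cases hNN₀ : N₀ ≤ N
    · -- small modulus, `N` large: Möbius over `e ∣ d` and Siegel–Walfisz
      have hlogN : (2 : ℝ) ^ (4 * A + 5) ≤ Real.log N := by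
        rw [hN₀] at hNN₀
        calc (2 : ℝ) ^ (4 * A + 5) = Real.log (Real.exp (2 ^ (4 * A + 5))) := (Real.log_exp _).symm
          _ ≤ Real.log N := Real.log_le_log (Real.exp_pos _) hNN₀
      have hlogN0 : 0 < Real.log N := Real.log_pos (by linarith)
      have hLle : L ≤ 2 * Real.log N := by
        rw [hLdef, Real.log_mul (by norm_num) (by linarith)]
        have : Real.log 2 ≤ Real.log N := Real.log_le_log (by norm_num) hN2
        linarith
      set P : ℝ := 3 * C * 4 ^ (A + 1) * N / L ^ (A + 1) + 3 * Real.sqrt N with hPdef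
      have hP0 : 0 ≤ P := by positivity
      have hsqrtN2 : 2 ≤ Real.sqrt N := by
        rw [show (2 : ℝ) = Real.sqrt 4 by
          rw [show (4 : ℝ) = 2 ^ 2 by norm_num, Real.sqrt_sq (by norm_num)]]
        exact Real.sqrt_le_sqrt hN
      -- the uniform class-sum bound at scale `N/e`
      have hPe : ∀ e ∈ d.divisors, ∀ c : ZMod k,
          |∑ m ∈ (dyadic (N / e)).filter (fun m : ℕ => (m : ZMod k) = c), (liouville m : ℝ)| ≤ P := by
        intro e he c
        have he1 : 1 ≤ e := Nat.pos_of_mem_divisors he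
        have he0 : (0 : ℝ) < e := by exact_mod_cast he1
        have hM0 : 0 ≤ N / e := by positivity
        by_cases hes : (e : ℝ) ≤ Real.sqrt N
        · -- `e ≤ √N`: Siegel–Walfisz at `y = N/e, 2N/e`
          have hMge : Real.sqrt N ≤ N / e := by
            rw [le_div_iff₀ he0]
            calc Real.sqrt N * e ≤ Real.sqrt N * Real.sqrt N :=
                  mul_le_mul_of_nonneg_left hes (Real.sqrt_nonneg _)
              _ = N := Real.mul_self_sqrt hN0
          have hM2 : 2 ≤ N / e := hsqrtN2.trans hMge
          have hlogM : Real.log N / 2 ≤ Real.log (N / e) := by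
            have h1 : Real.log (Real.sqrt N) = Real.log N / 2 := by
              rw [Real.sqrt_eq_rpow, Real.log_rpow (by linarith)]; ring
            rw [← h1]; exact Real.log_le_log (by linarith) hMge
          -- `k ≤ (log y)^{2A+3}` for `y ≥ N/e`
          have hky : ∀ y : ℝ, N / e ≤ y → (k : ℝ) ≤ Real.log y ^ (2 * A + 3) := by
            intro y hy
            have hly : Real.log N / 2 ≤ Real.log y :=
              hlogM.trans (Real.log_le_log (by linarith) hy)
            have hly0 : 0 ≤ Real.log N / 2 := by linarith
            refine hkL.trans ?_
            calc L ^ (2 * A + 2) ≤ (2 * Real.log N) ^ (2 * A + 2) :=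
                  Real.rpow_le_rpow hL0.le hLle (by linarith)
              _ ≤ (Real.log N / 2) ^ (2 * A + 3) := by
                  -- `(2L)^{2A+2} ≤ (L/2)^{2A+3}` iff `2^{4A+5} ≤ L`
                  rw [show (2 * A + 3 : ℝ) = (2 * A + 2) + 1 by ring,
                    Real.rpow_add (by linarith) _ 1, Real.rpow_one]
                  rw [show (2 : ℝ) * Real.log N = (Real.log N / 2) * 4 by ring,
                    Real.mul_rpow hly0 (by norm_num)]
                  refine mul_le_mul_of_nonneg_left ?_ (Real.rpow_nonneg hly0 _)
                  rw [show (4 : ℝ) = 2 ^ (2 : ℝ) by norm_num, ← Real.rpow_mul (by norm_num),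
                    show (2 : ℝ) * (2 * A + 2) = 4 * A + 4 by ring]
                  have : (2 : ℝ) ^ (4 * A + 5) = 2 ^ (4 * A + 4) * 2 := by
                    rw [show (4 * A + 5 : ℝ) = (4 * A + 4) + 1 by ring, Real.rpow_add (by norm_num),
                      Real.rpow_one]
                  linarith
              _ ≤ Real.log y ^ (2 * A + 3) := Real.rpow_le_rpow hly0 hly (by linarith)
          have hRy : ∀ y : ℝ, N / e ≤ y → y ≤ 2 * (N / e) →
              |∑ m ∈ (Icc 1 ⌊y⌋₊).filter (fun m : ℕ => (m : ZMod k) = c), (liouville m : ℝ)| ≤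
                C * 4 ^ (A + 1) * y / L ^ (A + 1) := by
            intro y hy hy2
            have hy2' : 2 ≤ y := hM2.trans hy
            have h1 := hC₁ y hy2' k hk (hky y hy) c
            have hly : Real.log N / 2 ≤ Real.log y :=
              hlogM.trans (Real.log_le_log (by linarith) hy)
            have hly4 : L / 4 ≤ Real.log y := by linarith
            have hlypos : 0 < Real.log y := by linarith
            calc _ ≤ C₁ * y / Real.log y ^ (A + 1) := h1
              _ ≤ C * y / Real.log y ^ (A + 1) := by
                  gcongr; exact le_max_left _ _
              _ ≤ C * y / (L / 4) ^ (A + 1) := by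
                  refine div_le_div_of_nonneg_left (by positivity) (Real.rpow_pos_of_pos (by linarith) _) ?_
                  exact Real.rpow_le_rpow (by linarith) hly4 (by linarith)
              _ = C * 4 ^ (A + 1) * y / L ^ (A + 1) := by
                  rw [Real.div_rpow hL0.le (by norm_num)]; field_simp
          calc _ ≤ |∑ m ∈ (Icc 1 ⌊2 * (N / e)⌋₊).filter (fun m : ℕ => (m : ZMod k) = c), (liouville m : ℝ)| +
                |∑ m ∈ (Icc 1 ⌊N / e⌋₊).filter (fun m : ℕ => (m : ZMod k) = c), (liouville m : ℝ)| :=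
                abs_sum_dyadic_class_le hM0 k c
            _ ≤ C * 4 ^ (A + 1) * (2 * (N / e)) / L ^ (A + 1) + C * 4 ^ (A + 1) * (N / e) / L ^ (A + 1) :=
                add_le_add (hRy _ (by linarith) le_rfl) (hRy _ le_rfl (by linarith))
            _ = 3 * C * 4 ^ (A + 1) * (N / e) / L ^ (A + 1) := by ring
            _ ≤ 3 * C * 4 ^ (A + 1) * N / L ^ (A + 1) := by
                refine div_le_div_of_nonneg_right ?_ (hLpow _).le
                refine mul_le_mul_of_nonneg_left (div_le_self hN0 (by exact_mod_cast he1)) (by positivity)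
            _ ≤ P := by rw [hPdef]; linarith [Real.sqrt_nonneg N]
        · -- `e > √N`: trivially
          push Not at hes
          have hMle : N / e ≤ Real.sqrt N := by
            rw [div_le_iff₀ he0]
            calc N = Real.sqrt N * Real.sqrt N := (Real.mul_self_sqrt hN0).symm
              _ ≤ Real.sqrt N * e := mul_le_mul_of_nonneg_left hes.le (Real.sqrt_nonneg _)
          calc _ ≤ ∑ m ∈ (dyadic (N / e)).filter (fun m : ℕ => (m : ZMod k) = c), |(liouville m : ℝ)| :=
                Finset.abs_sum_le_sum_abs _ _
            _ ≤ ∑ m ∈ dyadic (N / e), |(liouville m : ℝ)| :=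
                Finset.sum_le_sum_of_subset_of_nonneg (Finset.filter_subset _ _) fun _ _ _ => abs_nonneg _
            _ ≤ ∑ _m ∈ dyadic (N / e), (1 : ℝ) := Finset.sum_le_sum fun m _ =>
                Literature.NumberTheory.LFunctions.LiouvilleSum.abs_liouville_le_one m
            _ = #(dyadic (N / e)) := by simp
            _ ≤ 2 * (N / e) + 1 := card_dyadic_le hM0
            _ ≤ 3 * Real.sqrt N := by linarith
            _ ≤ P := by
                rw [hPdef]
                have : 0 ≤ 3 * C * 4 ^ (A + 1) * N / L ^ (A + 1) := by positivity
                linarith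
      have hmob := abs_disc_liouville_le_sum_divisors hN0 hd hk hl hPe
      refine hgoal _ (6 * (C * 4 ^ (A + 1) + cA)) (σ 0 d : ℝ) (hmob.trans ?_) (by positivity) hT2 hσ1
        (by rw [sq]; exact le_mul_of_one_le_left (by linarith) hσ1)
      have hcardσ : (#d.divisors : ℝ) = (σ 0 d : ℝ) := by
        rw [ArithmeticFunction.sigma_zero_apply]
      rw [Finset.sum_const, nsmul_eq_mul, hcardσ]
      -- `τ(d) · 2P ≤ 6 (C 4^{A+1} + cA) τ(d) N / L^{A+1/2}`
      rw [le_div_iff₀ (hLpow _)]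
      have hA1 : L ^ (A + 1 / 2) ≤ L ^ (A + 1) :=
        Real.rpow_le_rpow_of_exponent_le hL1 (by linarith)
      have e1 : 3 * C * 4 ^ (A + 1) * N / L ^ (A + 1) * L ^ (A + 1 / 2) ≤ 3 * C * 4 ^ (A + 1) * N := by
        rw [div_mul_eq_mul_div, div_le_iff₀ (hLpow _)]
        exact mul_le_mul_of_nonneg_left hA1 (by positivity)
      have e2 : 3 * Real.sqrt N * L ^ (A + 1 / 2) ≤ 3 * (cA * N) := by
        rw [mul_assoc]; exact mul_le_mul_of_nonneg_left hsqL (by norm_num)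
      have hσ0 : (0 : ℝ) ≤ (σ 0 d : ℝ) := by linarith
      calc (σ 0 d : ℝ) * (2 * P) * L ^ (A + 1 / 2)
          = (σ 0 d : ℝ) * (2 * (3 * C * 4 ^ (A + 1) * N / L ^ (A + 1) * L ^ (A + 1 / 2) +
              3 * Real.sqrt N * L ^ (A + 1 / 2))) := by rw [hPdef]; ring
        _ ≤ (σ 0 d : ℝ) * (2 * (3 * C * 4 ^ (A + 1) * N + 3 * (cA * N))) := by
            gcongr
        _ = 6 * (C * 4 ^ (A + 1) + cA) * (σ 0 d : ℝ) * N := by ring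
    · -- small modulus, `N < N₀`: trivially
      push Not at hNN₀
      have htriv := abs_disc_le_two_sum_abs (N := N) (fun n => (liouville n : ℝ)) hk (l : ZMod k) d
      refine hgoal _ (5 * L₀ ^ (A + 1 / 2)) 1 (htriv.trans ?_) (by positivity) hT3 le_rfl hσd
      clear htriv hgoal
      have hsum : ∑ n ∈ dyadic N, |(liouville n : ℝ)| ≤ 2 * N + 1 := by
        calc ∑ n ∈ dyadic N, |(liouville n : ℝ)| ≤ ∑ _n ∈ dyadic N, (1 : ℝ) :=
              Finset.sum_le_sum fun n _ => Literature.NumberTheory.LFunctions.LiouvilleSum.abs_liouville_le_one n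
          _ = #(dyadic N) := by simp
          _ ≤ 2 * N + 1 := card_dyadic_le hN0
      have h2N : (0 : ℝ) < 2 * N := by linarith only [hN]
      have h2NN : 2 * N ≤ 2 * N₀ := by linarith only [hNN₀]
      have hlogle : Real.log (2 * N) ≤ Real.log (2 * N₀) := Real.log_le_log h2N h2NN
      have hLL₀ : L ≤ L₀ := by
        have e1 : L = Real.log (2 * N) := hLdef
        have e2 : L₀ = Real.log (2 * N₀) + 1 := hL₀
        linarith only [e1, e2, hlogle]
      have hL₀0 : 0 ≤ L₀ := by linarith only [hL₀1]
      have hApos : 0 ≤ A + 1 / 2 := by linarith only [hA]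
      have hpowL : L ^ (A + 1 / 2) ≤ L₀ ^ (A + 1 / 2) := Real.rpow_le_rpow hL0.le hLL₀ hApos
      have hpow0 : 0 ≤ L₀ ^ (A + 1 / 2) := Real.rpow_nonneg hL₀0 _
      rw [le_div_iff₀ (hLpow _)]
      have h5 : 2 * ∑ n ∈ dyadic N, |(liouville n : ℝ)| ≤ 5 * N := by linarith only [hsum, hN]
      have hN5 : 0 ≤ 5 * N := by linarith only [hN]
      calc (2 * ∑ n ∈ dyadic N, |(liouville n : ℝ)|) * L ^ (A + 1 / 2) ≤ (5 * N) * L₀ ^ (A + 1 / 2) :=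
            mul_le_mul h5 hpowL (hLpow _).le hN5
        _ = 5 * L₀ ^ (A + 1 / 2) * 1 * N := by ring

/-- **Hypothesis (A₂) of BFI for the Liouville function.**  There is a family of constants
`Csw : ℝ → ℝ` such that `β = λ` satisfies `SiegelWalfiszHyp N 2 Csw β` at every scale `N ≥ 4`
(the absolute bound `abs_disc_liouville_le` in BFI's relative form, `‖λ‖² = #{n ∼ N} ≥ N/2`). -/
theorem siegelWalfiszHyp_liouville :
    ∃ Csw : ℝ → ℝ, ∀ N : ℝ, 4 ≤ N → SiegelWalfiszHyp N 2 Csw (fun n => (liouville n : ℝ)) := by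
  classical
  have h := fun A : {A : ℝ // 0 < A} => abs_disc_liouville_le A.1 A.2
  choose T hT using h
  refine ⟨fun A => if hA : 0 < A then T ⟨A, hA⟩ else 0, fun N hN A hA d k hd hk l hl => ?_⟩
  obtain ⟨hT0, hTb⟩ := hT ⟨A, hA⟩
  have hX := hTb N hN d k hd hk l hl
  simp only [dif_pos hA]
  have hN0 : 0 < N := by linarith
  have hL : 1 ≤ Real.log (2 * N) := by
    have : Real.exp 1 ≤ 2 * N := by linarith [Real.exp_one_lt_d9]
    calc (1 : ℝ) = Real.log (Real.exp 1) := (Real.log_exp 1).symm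
      _ ≤ Real.log (2 * N) := Real.log_le_log (Real.exp_pos 1) this
  have hL2 : 2 ≤ Real.log (2 * N) := by
    have h2 : Real.exp 2 = Real.exp 1 * Real.exp 1 := by rw [← Real.exp_add]; norm_num
    have : Real.exp 2 ≤ 2 * N := by nlinarith [Real.exp_one_lt_d9, Real.exp_one_gt_d9]
    calc (2 : ℝ) = Real.log (Real.exp 2) := (Real.log_exp 2).symm
      _ ≤ Real.log (2 * N) := Real.log_le_log (Real.exp_pos 2) this
  have hdens : N ≤ Real.log (2 * N) ^ (1 : ℝ) * l2Sq N (fun n => (liouville n : ℝ)) := by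
    rw [Real.rpow_one]
    have := l2Sq_liouville_ge (N := N) (by linarith)
    nlinarith [l2Sq_nonneg N (fun n => (liouville n : ℝ))]
  have hrel := relative_of_absolute (Cs := T ⟨A, hA⟩) (cD := 1) (A := A) hT0 le_rfl hN0 hL rfl
    hdens hX
  rw [← Finset.sum_filter, ← Finset.sum_filter, Real.rpow_two]
  exact hrel

end Summit.Parity.GeneralizedHardyLittlewood.Theorems
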